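import Mathlib
import HarnessLib
import HarnessLib.Audit
import Summits.CriticalPhenomena.Statement
import Literature.MathematicalPhysics.QuantumLattice.EuclideanAction
import Summits.CriticalPhenomena.Ising3DConformalLimit.Theorems.PositivityBegetsConformalityExistsScaleCovariantLimitItemMaps
import HarnessLib.Audit.Status.Attr

/-!
Route: MarkovRigidity

# Route MarkovRigidity — locality is a sigma-algebra — germ-Markov inheritance of the Ising limit
plus Nelson–Polyakov rigidity of scalar Markov fields gives Moebius covariance, isotropy included

It suffices to show X_MR = (E₀) ∧ (MI) ∧ (NPR) ∧ (NG), realising card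
markov-rigidity-locality-sigma-algebra ("locality is a
σ-algebra"). (E₀) ExistsScaleCovariantLimit: the critical n.n. Ising correlators on ℤ³ have a
non-degenerate, translation-invariant,
scale-covariant (one Δ > 0) pointwise scaling limit S, normalised to 0 off NonCoincident — NO
rotation and NO inversion clause (item 1981 of
HyperoctahedralRP, verbatim). (MI) MarkovInheritance: every probability law μ on 𝒮'(ℝ³) with
exponential moments whose moment densities
are such a limit S has McKean's GERM-MARKOV property for all open balls and open half-spaces:
writing Σ(A) for the σ-algebra generated by
ω(f), tsupport f ⊆ A, the inner germ field ⋂_ε Σ(U_ε) and the outer germ field ⋂_ε Σ((Uᶜ)_ε) are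
conditionally independent given the
boundary germ ⋂_ε Σ((∂U)_ε) (stated as E[F | outer ∨ germ] = E[F | germ] a.e. for bounded
inner-measurable F). (NPR) NelsonPolyakovRigidity,
lattice-free: a probability law μ on 𝒮'(ℝ³) (one real scalar field) with all and exponential
moments, translation invariant, scale
covariant with 1/2 ≤ Δ ≤ 1, time-reflection invariant and OS-reflection positive, time-clustering,
germ-Markov as above, whose moment
densities S are continuous and normalised on NonCoincident with S₂ > 0, has S∘A Möbius covariant
with weight Δ for some A ∈ GL(3,ℝ).
(NG) NonGaussianity: every non-degenerate pointwise scaling limit of criticalCorr 3 has U₄ ≢ 0 (item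
0636, verbatim, imported).
Glue (support): FieldRealisation (the pointwise limit is the moment density of such a law μ, with
RP, θ-invariance, clustering and law-level
covariance inherited from the lattice), CubicSymmetryOfLimit (S is invariant under signed
permutation matrices), CubicClosure (S∘A Möbius
+ S hyperoctahedral-invariant ⇒ A is a similarity ⇒ S Möbius). The Gaussian shadow of NPR is
recorded as the provable-now lemma
HomogeneousEntireRigidity (an entire function positively homogeneous of degree m ∈ (0,3) with
locally integrable reciprocal on ℝ³ is a
positive-definite quadratic form, m = 2: "Markov + scale ⇒ free field of a metric, Δ = 1/2, isotropy
up to GL(3) for free").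
Lean: `MarkovInheritance ∧ NelsonPolyakovRigidity ∧ ExistsScaleCovariantLimit ∧ NonGaussianity`

## Assembly
Pure logic plus one PROVED Literature theorem (checked sorry-free in the planner's Sketch.lean,
theorem assembly_holds, axioms propext/choice/Quot.sound): take (ρ, Δ, S) from
ExistsScaleCovariantLimit; FieldRealisation gives continuity of S on NonCoincident and a law μ with
moments/exp-moments/densities S/translation/scale/θ/RP/clustering; MarkovInheritance makes μ
germ-Markov; Literature.Probability.LatticeModels.scalingDimension_mem_Icc_holds gives 1/2 ≤ Δ ≤ 1;
NelsonPolyakovRigidity gives A with S∘A Möbius; CubicSymmetryOfLimit gives B₃-invariance of S;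
CubicClosure gives IsMoebiusCovariant Δ S; NonGaussianity gives HasNontrivialU4 S; conclude ⟨ρ, Δ,
S, …⟩ : Ising3DConformalLimit. No separate isotropy crux and no separate inversion crux.

Rationale: WHY THIS LINE. Polyakov's "scale + locality ⇒ conformal" (Polyakov1970; status in d = 3:
Nakayama2015, DelamotteTissierWschebor2016, MenesesEtAl2019) has no
agreed mathematical form on ℤ³ because locality is usually a stress tensor, which a lattice limit
does not hand over; the n.n. Ising
measure hands over something else exactly and at every mesh — the global Markov property with the
explicit boundary-field kernel
⟨·⟩^{h(ξ)}_{Λ,β_c} (Goldstein1980; in tree GibbsSpecification) — so the card takes McKean's germ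
σ-algebras (McKean1963, Pitt1971,
Nelson1973FreeMarkoff, Nelson1973Construction, Rozanov1982) as the probabilistic meaning of locality
and splits clause (ii) into a LATTICE
statement MI (inheritance of the Markov property by the interacting limit) and a CLASSIFICATION
statement NPR about Markov fields, whose
Gaussian case is a theorem with teeth: Kotani1973 Thm 2 / Pitt1971 (germ-Markov ⟺ σ⁻¹ entire of
minimal exponential type) plus homogeneity
force σ⁻¹ to be a quadratic form (HomogeneousEntireRigidity), i.e. the free field of a METRIC — Δ =
1/2 and isotropy up to GL(3) with no
rotation hypothesis, after which the cubic symmetry of ℤ³ kills the metric (CubicClosure). Imported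
areas: Markov random fields and
splitting σ-algebras (probability 1963–1982), Euclidean field theory à la
Nelson/Osterwalder–Schrader (RP, reconstruction on planes and, by
sphere-Markov + dilations, a radial semigroup whose reversibility is inversion covariance), several
complex variables (Paley–Wiener type
rigidity). What it does that prior routes do not: IsingEuclidUpgrade (U) and HyperoctahedralRP
(B),(D) upgrade from symmetry/RP data of the
correlation FAMILY and need isotropy as a separate crux; here the extra hypothesis is germ-Markov of
the limit LAW (the scope caveat (a) of
ScaleCovarianceNotMoebius), rotations and inversion sit inside ONE rigidity statement, and isotropy
needs no engine beyond cubic symmetry;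
AnomalousForcesInteraction (sibling card) points the same Gaussian rigidity at clause (iii) only and
keeps Markov inheritance inside a
Gaussian hypothesis — this route needs it for the interacting limit and files it as the rank-2 crux.

RANKED CRUXES. #2 MarkovInheritance (crux) — (MI) of the card. For every renormalisation ρ > 0 on
(0,1], Δ, correlation family S and probability law μ on FieldConfig ℝ³ = 𝒮'(ℝ³): if S is a pointwise
scaling limit of criticalCorr 3 (locally uniformly on non-coincident configurations), normalised to
0 off NonCoincident, with non-degenerate two-point function, translation invariant and scale
covariant with dimension Δ, and μ has all moments, exponential moments and moment densities S
(HasMomentDensity μ S — by Gaussian domination μ is then THE Ising limit law), then μ is germ-Markov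
in McKean's sense for every open ball and every open half-space U: for Σ(A) := ⨆_{tsupport f ⊆ A}
σ(ω ↦ ω f), every bounded F measurable for the inner germ field ⋂_{ε>0} Σ(U_ε) satisfies E_μ[F | ⋂_ε
Σ((Uᶜ)_ε) ∨ ⋂_ε Σ((∂U)_ε)] = E_μ[F | ⋂_ε Σ((∂U)_ε)] μ-a.e. Intended proof: the n.n. plus state is
globally Markov with kernel E[F(σ_Λ) | σ_{Λᶜ} = ξ] = ⟨F⟩^{h(ξ)}_{Λ,β_c}, h_y(ξ) = β_c Σ_{z∼y, z∉Λ}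
ξ_z, depending on ξ only through the lattice germ of ∂Λ at every mesh; show these kernels converge
compatibly along the field scaling limit (uniform control of ⟨·⟩^{h}_{Λ} in the random boundary
field h without linearisation: GHS / random currents), then identify the limit conditional
expectations with germ-measurable variables. [difficulty: XL] (why it might fail: Conditional
independence is not weakly closed: an O(δ) shell may carry ε-sector data that the σ-germ of the
limit does not generate (global Markov fails for some Gibbs states, Israel1986); the kernel
⟨·⟩^{h(ξ)}_Λ needs mesh-uniform control in a rough random field h.) [Goldstein1980, Israel1986,
AlbeverioHeghkrohnZegarlinski1989, McKean1963, Nelson1973Construction, Rozanov1982,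
Newman1975Gaussian, Kotani1973]
#3 NelsonPolyakovRigidity (crux) — (NPR) of the card, single real scalar field (load-bearing: for
multiplets it is false — linear elasticity, RivaCardy2005 / ElshowkNakayamaRychkov2011; a single
elastic component u₁ is NOT germ-Markov since 1/σ₁₁ = μ‖k‖⁴/((1−γ)k₁²+k₂²+k₃²) is not entire),
lattice-free. For every probability law μ on 𝒮'(ℝ³), Δ and S: if μ has all moments and exponential
moments, is translation invariant, scale covariant with dimension Δ (law level: ω ↦ ω∘(f ↦
s^{Δ−3}f(·/s)) preserves μ), invariant under the time reflection θ: x₀ ↦ −x₀, OS3 reflection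
positive w.r.t. θ, OS4 time-clustering (S{f + T_t g} → S{f}S{g}; excludes the germ-Markov
non-clustering MIXTURES ½(GFF_{Q₁} + GFF_{Q₂}), a counterexample to the unclustered statement),
germ-Markov for all open balls and open half-spaces exactly as in MarkovInheritance, 1/2 ≤ Δ ≤ 1,
and its moment densities S (HasMomentDensity μ S) are normalised to 0 off NonCoincident, continuous
on NonCoincident and have S₂ > 0 there — then there is a continuous linear automorphism A of ℝ³ such
that (n, x) ↦ S n (A ∘ x) is Möbius covariant with weight Δ (Euclidean invariant, scale covariant,
unit-inversion covariant). Gaussian case = Kotani1973 Thm 2 + HomogeneousEntireRigidity + Wick (Δ =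
1/2, A = Q^{-1/2}); sub-targets: isotropy half (E(3) up to GL(3)) and inversion half (reversibility
of the radial Nelson semigroup on the unit-sphere germ generated by dilations, from planar RP +
sphere-Markov). [difficulty: open-problem] (why it might fail: It is Polyakov's conjecture in
Nelson's axioms: a non-Gaussian scalar germ-Markov RP scale-covariant field with a dimension-2
virial current may exist in d=3 (none known; non-unitary holographic SFTs: Nakayama2017; Ising Δ_V>5
only numerically); Gaussian case needs Kotani (1.3)–(1.4).) [Polyakov1970, Nakayama2015,
Nakayama2017, DelamotteTissierWschebor2016, MenesesEtAl2019, ElshowkNakayamaRychkov2011,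
RivaCardy2005, Kotani1973, Pitt1971, Dobrushin1979, Nelson1973FreeMarkoff, IwataSchafer1997]
#4 ExistsScaleCovariantLimit (crux) — (E₀) of the card = item 1981 of route HyperoctahedralRP
verbatim (shared): there are ρ > 0 on (0,1], Δ > 0 and S with HasPointwiseScalingLimit (criticalCorr
3) ρ S, S = 0 off NonCoincident, IsNondegenerateTwoPoint S, IsTranslationInvariant S,
IsScaleCovariant Δ S. No rotation and no inversion clause: on this route both are OUTPUT of NPR +
CubicClosure. Inputs in tree: criticalTwoPoint_bounds_holds, scalingDimension_mem_Icc_holds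
(subsequential limits, Δ ∈ [1/2,1]); missing: full-filter convergence and continuous scale
covariance (DuminilCopinICM2022 §8.4: existence of the limits is 'widely open'). [difficulty:
open-problem] (why it might fail: Full δ→0⁺ convergence with ONE continuous Δ is open on ℤ³: the
two-point bounds give only subsequential limits, and RP/GKS two-point axiomatics admit log-periodic
(discretely scale-covariant) profiles.) [DuminilCopinICM2022, DuminilcopinPanis2025,
AizenmanDuminilCopinAnnals2021, Literature.Probability.LatticeModels.scalingDimension_mem_Icc_holds]
#5 NonGaussianity (crux) — (NG), imported complement = item 0636 verbatim (shared with
IsingEuclidUpgrade r4 / HyperoctahedralRP / IsingCFTData): every pointwise scaling limit S of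
criticalCorr 3 with ρ > 0 on (0,1] and non-degenerate two-point function has HasNontrivialU4 S. This
route does not attack clause (iii); it bets on 0636's routes or on the sibling
AnomalousForcesInteraction / PerfectScreening dichotomies. [difficulty: open-problem] (why it might
fail: No proof that U₄ ≢ 0 in d = 3: the double-current intersection probability at macroscopic
separation must stay positive as δ → 0; RP long-range models on ℤ³ with α < 3/2 are Gaussian
(LongRangeTrivialityOnZ3).) [AizenmanDuminilCopinAnnals2021, DuminilCopinICM2022,
Panis2023Triviality]
#9 FieldRealisation (support) — Glue from the pointwise limit to the field: for every ρ > 0 on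
(0,1], Δ, S with the hypotheses of ExistsScaleCovariantLimit, (a) each S n is continuous on
NonCoincident 3 n (translation invariance + locally uniform convergence of cell-wise constant
functions), and (b) there is a probability law μ on 𝒮'(ℝ³) with all moments, exponential moments
(Newman's Gaussian-type inequalities for the Lee–Yang class pass to the limit), moment densities S
(smeared moments: Potter bounds for the regularly varying ρ + Gaussian domination |S_{2n}| ≤
Σ_pairings ΠS₂ give uniform integrability near diagonals, 2Δ ≤ 2 < 3), translation-invariant and
scale-covariant law (moment determinacy from exponential moments), invariant under θ: x₀ ↦ −x₀, OS3
reflection positive (site-reflection positivity of the n.n. model through the plane x₀ = 0,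
FrohlichIsraelLiebSimon1978, passes to limits of generating functionals) and OS4 time-clustering
(truncated correlations decay like t^{-2Δ} by Lebowitz-type domination). μ is the limit in law of
the rescaled spin fields (cf. Ising3DFieldScalingLimit), but only its moment characterisation is
asserted. [difficulty: L] [Newman1975Gaussian, GlimmJaffe1987, FrohlichIsraelLiebSimon1978,
OsterwalderSchrader1973, AizenmanDuminilCopinSidoravicius2015]
#9 CubicSymmetryOfLimit (support) — Hyperoctahedral (B₃ = signed permutation) invariance of the
limit: for every ρ > 0 on (0,1], Δ, S with the hypotheses of ExistsScaleCovariantLimit and every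
linear isometry L of ℝ³ permuting the set {±e_i}, S n (L∘x) = S n x for all n and all configurations
x. From invariance of the critical plus state under lattice automorphisms of ℤ³ fixing 0 (coordinate
permutations commute with the floor map latticeApprox; sign changes are off by one lattice unit,
absorbed by translation invariance and the continuity of S on NonCoincident; off NonCoincident both
sides vanish by normalisation, L being injective). [difficulty: M] [FriedliVelenik2017,
DuminilCopinICM2022]
#9 CubicClosure (support) — Elementary glue 'an O_h-invariant metric is round': for Δ > 0, a
correlation family S on ℝ³ with S₂ > 0 on NonCoincident which is invariant under all signed
permutation isometries, and a continuous linear automorphism A with S∘A Möbius covariant of weight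
Δ, S itself is Möbius covariant of weight Δ. Proof: rotation + scale invariance of S∘A give
(S∘A)₂(0,u) = g₀‖u‖^{-2Δ}, g₀ > 0, so S₂(0,w) = g₀‖A⁻¹w‖^{-2Δ}; B₃-invariance of S and Δ ≠ 0 make
the quadratic form ‖A⁻¹w‖² B₃-invariant, hence λ‖w‖² (sign flips kill off-diagonal entries,
transpositions equalise the diagonal), so A⁻¹ = √λ·R with R ∈ O(3) and S n = λ^{-nΔ/2}·(S∘A) n; all
four covariance properties are stable under n-dependent positive constants. [difficulty:
provable-now] [PolandRychkovVichi2019, FrancescoMathieuSenechal1997]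
#9 HomogeneousEntireRigidity (support) — The Gaussian shadow of NPR after Kotani's criterion, pure
complex analysis (provable now): if P : ℂ³ → ℂ is entire (analytic at every point), real and ≥ 0 on
ℝ³, not identically 0 on ℝ³, positively homogeneous of degree m ∈ (0,3) on ℝ³ (P(ck) = c^m P(k), c >
0) and 1/P is locally integrable on ℝ³, then m = 2 and P|ℝ³ is a positive-definite quadratic form k
↦ Σ Q_ij k_i k_j. Proof: for real k, t ↦ P(tk) is entire in t ∈ ℂ and equals t^m P(k) for t > 0, so
single-valuedness forces m ∈ ℕ or P(k) = 0; hence m ∈ {1,2} and P|ℝ³ is a homogeneous polynomial of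
degree m; m = 1 contradicts P ≥ 0, P ≢ 0; m = 2 gives a PSD form whose reciprocal is locally
integrable in ℝ³ only at full rank. With Kotani1973 Thm 2 (σ⁻¹ = P entire of minimal exponential
type for a germ-Markov stationary Gaussian field) and σ⁻¹ homogeneous of degree 3 − 2Δ this is
'Markov + scale ⇒ massless free field of the metric Q, Δ = 1/2'. [difficulty: provable-now]
[Kotani1973, Pitt1971, Dobrushin1979, Rozanov1982]

TWO-LAYER PLAN. Foreseen glued splits (none filed now; k ≤ 3, depth 1). NelsonPolyakovRigidity ⇐
NPRGaussian → NPRInteracting → NelsonPolyakovRigidity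
(case split on IsGaussianField μ; NPRGaussian = cite fact Kotani1973 Thm 2 for generalized fields +
HomogeneousEntireRigidity + Wick),
or, by content, NelsonPolyakovRigidity ⇐ NPRIsotropy (S∘A Euclidean invariant: 'anisotropy of a
scalar Markov fixed point is a metric')
→ NPRInversion (reversibility of the radial Nelson semigroup given planar RP + sphere-Markov +
Euclidean invariance) → NelsonPolyakovRigidity.
MarkovInheritance ⇐ MIHalfSpaces → MIBalls → MarkovInheritance, or MarkovInheritance ⇐
BoundaryKernelTightness (mesh-uniform control of
⟨·⟩^{h(ξ)}_Λ) → GermGeneration (limits of boundary-layer observables are germ-measurable) →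
MarkovInheritance. FieldRealisation ⇐
GaussianDominationOfLimit → PotterBounds → FieldRealisation once a prover asks.
ExistsScaleCovariantLimit and NonGaussianity are owned by
the existence / U₄ routes and are not split here.

KILL CRITERIA. A single non-Gaussian (or Gaussian!) law μ meeting every hypothesis of
NelsonPolyakovRigidity with no A making S∘A Möbius covariant refutes
NPR and closes the route (close --reason refuted:NelsonPolyakovRigidity); the witness would itself
be notable (a rigorous reflection-positive
Markov SFT-not-CFT in d = 3) and becomes a barrier entry 'Markov + RP + scale ⇏ Möbius'. A proof
that the σ-germ of the Ising limit does
NOT split inside from outside (e.g. via an ε-sector observable measurable across but not along the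
boundary) refutes MarkovInheritance and
closes the route; the Gaussian dichotomy of AnomalousForcesInteraction would fall with it.
Refutation of ExistsScaleCovariantLimit (two
subsequential Δ's, log-periodicity) kills every single-Δ route to the conjunct as typed; refutation
of NonGaussianity refutes the conjunct
itself (file ¬Ising3DConformalLimit). If MoebiusLimit (item 1344) is proved through
IsingEuclidUpgrade / HyperoctahedralRP / IsingCFTData
first, this route is superseded for the summit (NPR keeps independent interest as a classification
statement).

NOT DECOMPOSED YET. Inside MI: the boundary-field kernel estimates (GHS / random-current expansions
in h(ξ)), tightness of conditional laws, and the
identification 'limits of boundary-layer observables are germ-measurable' (the ε-sector question);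
inside NPR: Nelson reconstruction on
planes AND spheres, the so(4,1)-integration / reversibility argument, and the generalized-field
bookkeeping of Kotani's hypotheses
(1.3)–(1.4) for σ⁻¹ ∝ ‖k‖^{3−2Δ}×(angular factor) (Dobrushin1979); inside FieldRealisation: Potter
bounds for ρ, Gaussian domination of S,
moment determinacy, passage of site-RP and clustering to the limit; the lattice automorphism
invariance of criticalCorr 3 behind
CubicSymmetryOfLimit. All are layer-2 children or --supports lemmas. Deliberately NOT decomposed:
ExistsScaleCovariantLimit (owned by the
existence/covariance routes; card rp-cannot-fix-the-scale-log-periodic shows two-point RP axiomatics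
cannot give it) and NonGaussianity
(0636 routes, AnomalousForcesInteraction, PerfectScreening).

CHEAPEST FALSIFIER. Run NPR's hypothesis list against the catalogue of scale-but-not-conformal or
anisotropic objects (done on paper this session, none
survives — the refuter should redo it adversarially): generalized free fields ‖k‖^{-(3−2Δ)}, Δ ≠ 1/2
(Panis's long-range limits): not
germ-Markov; single elastic component u₁ and ∂φ, F_{ij} of free Maxwell d=3: not germ-Markov
(reciprocal spectral density not entire);
white noise in one direction (Δ = 1/2, trivially Markov): S₂ not a function; mixtures
½(GFF_{Q₁}+GFF_{Q₂}): Markov, RP, scale covariant but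
not clustering — the reason IsOS4Clustering is a hypothesis. Second cheapest: decide the germ-Markov
property of the PLANAR continuum
magnetization field (Camia–Garban–Newman, arXiv:1205.6610, where σ, ε and the CLE₃/FK structure are
explicit); if σ alone is not
germ-Markov in 2D, MarkovInheritance on ℤ³ is implausible and the route should close. Third: prove
HomogeneousEntireRigidity and
CubicClosure (provable now) — failure of either as typed means the typing, not the line, is wrong.

NUMBERS. Δ_σ = 0.5181489(10), η = 0.0362978(20) (PolandRychkovVichi2019, bootstrap); rigorous window
Δ ∈ [1/2, 1] for any non-degenerate
scale-covariant pointwise limit (scalingDimension_mem_Icc_holds, PROVED) — used to discharge NPR's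
window in the assembly; a virial current
needs a vector of dimension exactly 2, Monte-Carlo Δ_V > 5.0 (MenesesEtAl2019); Gaussian germ-Markov
+ scale ⇒ Δ = 1/2 exactly (Kotani1973
Thm 2: σ⁻¹ entire of minimal exponential type under (1.3) σ⁻¹ ∈ L¹_loc and (1.4); necessity uses
Markov for small balls only, LNM 330
p. 159); long-range Gaussian limits on ℤ³ have Δ = (3−α)/2 ≠ 1/2 for α < 3/2 (Panis2023Triviality
Thm 1.2) and are not Markov. Items at open:
9 (4 cruxes, 4 support, 1 assembly).

DEFINITION REQUESTS. (1) notion IsGermMarkovLaw (McKean 1963 / Pitt 1971 / Kotani 1973 Def. 1 /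
Rozanov 1982 ch. 2–3): for a law μ on FieldConfig E and an
open U ⊆ E, with Σ(A) := ⨆_{tsupport f ⊆ A} σ(ω ↦ ω f): CondIndep of ⋂_ε Σ(U_ε) and ⋂_ε Σ((Uᶜ)_ε)
given ⋂_ε Σ((∂U)_ε) — the formula
inlined in MarkovInheritance / NelsonPolyakovRigidity; shared with AnomalousForcesInteraction's
request of the same name; --for
MarkovInheritance. (2) cite fact wanted once (1) lands: Kotani1973 Thm 2 (with Pitt1971, Künsch 1979
zbl:0408.60038, IwataSchafer1997 for
the generalized-field setting): a stationary centred Gaussian generalized field on ℝ^d with spectral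
density σ, σ⁻¹ ∈ L¹_loc of
controlled growth, is germ-Markov for all bounded open sets iff σ⁻¹ is a.e. the restriction of an
entire function of minimal exponential
type. (3) optional notion (shared with the sibling): stationary Gaussian generalized field with
given spectral measure (Dobrushin1979).

Novelty: Searches (2026-08-15): `lit search --hybrid "Markov property stationary Gaussian random field
spectral density entire function minimal
exponential type"` (8 docs; hit 1 = LNM 330: Kotani pp. 153–161 and Okabe pp. 212–219 READ — Def. 1
p. 158, Thm 2 p. 155, necessity via
small balls p. 159, McKean's germ fields (1.2) p. 213); `lit frontier CriticalPhenomena --since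
2021` (30 rows, none on Markov/locality of
3D limits; arXiv:2604.05772 noted); `lit bridges CriticalPhenomena --cross any` (30 rows, surveys);
zbMATH ×5 ("Markov property self-similar
Gaussian field", "Gaussian Markov random field spectral density polynomial", "scale invariance
conformal invariance Markov", "Markov field
dilation reflection positivity" (0), "germ Markov generalized random field" → Künsch 1979
zbl:0408.60038, Mandrekar–Zhang 1993
zbl:0792.60040, Schäfer 1993 zbl:0833.60046, IwataSchafer1997); crossref ("Markov property scale
invariant random field conformal
invariance" → Polchinski1988ScaleConformal, Nakayama2017 = doi:10.1103/physrevd.95.046006, a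
holographic non-unitary 3D SFT-not-CFT; DOIs of
Goldstein1980, Israel1986, McKean1963, Nelson 1973 ×2 added to references.bib); `lit galaxy search
"Markov property of the scaling limit"
--star all` and `--star pdf "Markov property and conformal invariance"`: galaxyd saturated (rc 3 /
rc 1, 0 rows); OpenAlex / arXiv / S2:
HTTP 429 all session; plus the card's and the refuter audit's searches (doi:10.1007/bf00252003 Pitt,
doi:10.1214/aop/1176995145 Dobrushin  [refs: 10.1103/physrevd.95.046006, 10.1007/bf00252003, 10.1214/aop/1176995145, 2604.05772, doi:10.1103/physrevd.95.046006, doi:10.1007/bf00252003, doi:10.1214/aop/1176995145, IwataSchafer1997, Nakayama2017, Goldstein1980, Israel1986, McKean1963, Kotani1973, Pitt1971, Rozanov1982, Dobrushin1979, AlbeverioHeghkrohnZegarlinski1989, Polyakov1970, Nakayama2015, DelamotteTissierWschebor2016, MenesesEtAl2019]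

Barriers (technique_class: markov-rigidity, germ-sigma-algebra, os-reconstruction): - technique_class: markov-rigidity, germ-sigma-algebra, os-reconstruction
- Literature.Barriers.CriticalPhenomena.ScaleCovarianceNotMoebius: evaded by hypothesis enlargement,
explicitly its scope caveat (a): not_euclideanScaleUpgrade / not_inversionUpgrade_of_euclidean_data
kill upgrades from Euclidean + scale data of a bare CorrFamily; NPR's inputs are germ-Markov + OS
reflection positivity + clustering of a LAW whose moments are S (the barrier's witness is not
clustering and is not the moment family of an RP Markov law), and MI / E₀ keep
HasPointwiseScalingLimit (criticalCorr 3). The typed lesson of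
Theorems/IsingEuclidUpgradeRefutations.lean (values on the coincident locus) is built in: S
normalised off NonCoincident and continuous on it in MI, NPR, E₀. Honest residue: NPR is unproved
beyond the Gaussian class.
- Literature.Barriers.CriticalPhenomena.LongRangeTrivialityOnZ3: consistent and USED — the algebraic
couplings are not Markov specifications and Panis's Gaussian limits (Δ = (3−α)/2 ≠ 1/2) are exactly
the non-Markov self-similar fields that Kotani's criterion classifies away; MI is stated for
criticalCorr 3 (n.n.) only, so no step is interaction-uniform (InteractionUniformZ3 fails at MI).
- Literature.Barriers.CriticalPhenomena.IsingTrivialityFromDimensionFour: not engaged — clause (iii)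
is imported (NonGaussianity = 0636) and nothing dimension-specific is claimed by MI / NPR, which are
TRUE and consistent in d ≥ 5 (the limit is the massless GFF: Markov, Möbius, Δ =

History (route lifecycle, newest last):
- 2026-08-15T12:11:53Z · rev 2: restated Assembly (stmt-CriticalPhenomena-6232) — fix assembly: the conjunct is the root-level abbrev Ising3DConformalLimit (not Summit.CriticalPhenomena.Ising3DConformalLimit), and the shared item 0636 is rend (planner-plancard-CriticalPhenomena-Ising3DCon-4258a1ae-0)
- 2026-08-15T16:54:15Z · rev 4: restated MarkovInheritance (stmt-CriticalPhenomena-6226), NelsonPolyakovRigidity (stmt-CriticalPhenomena-6227), FieldRealisation (stmt-CriticalPhenomena-6228) — cone repair (route-repair g2): drop imports Literature.Probability.LatticeModels.FieldScalingLimit (carried the unproved facts Ising3DFieldScalingLimit  (planner-rrepair-CriticalPhenomena-MarkovRigidi-48a4577e-g2-0)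
- 2026-08-25T16:00:33Z · DORMANT — reconciler: no traction for 7.8 d (last activity item-evidence-added at 2026-08-17T19:18:53Z); parked, not closed — `ledger route dormant route-CriticalPhenomen (operator:999:2279538)
- 2026-08-27T15:22:09Z · REACTIVATED — reconciler: reactivated — activity statement-checked at 2026-08-27T13:51:04Z after parking at 2026-08-25T16:00:33Z (operator:999:1160895)

sub-problem: Ising3DConformalLimit · status: open · opened planner-plancard-CriticalPhenomena-Ising3DCon-4258a1ae-0 2026-08-15T11:45:12Z · rev 5 · ledger route-CriticalPhenomena-MarkovRigidity
GENERATED by the gate from the ledger (D-0016/17). Provers cite these decls: `theorem foo : Summit.CriticalPhenomena.Ising3DConformalLimit.Theses.MarkovRigidity.<Decl> := …` in Summits/CriticalPhenomena/Ising3DConformalLimit/Theorems/<Name>.lean.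
-/

namespace Summit.CriticalPhenomena.Ising3DConformalLimit.Theses.MarkovRigidity

open scoped BigOperators Topology Manifold Classical MeasureTheory ProbabilityTheory Matrix InnerProductSpace ComplexConjugate ContinuousMap
open Filter Set Function TopologicalSpace MeasureTheory

attribute [summit_statement] _root_.Ising3DConformalLimit

-- earlier MarkovInheritance (stmt-CriticalPhenomena-6226, replaced 2026-08-15T16:54:15Z -> stmt-CriticalPhenomena-11236): retired by None — ∀ (ρ : ℝ → ℝ) (Δ : ℝ) (S : Literature.Probability.LatticeModels.CorrFamily 3) (μ : MeasureTheory.Measure (Literature.MathematicalPhysics.QuantumLattice.FieldConfig (EuclideanSpace ℝ (Fin 3)))), (∀ δ ∈ Set.Ioc (0:ℝ) 1, 0 < ρ δ) → Literature.Probability.LatticeMod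
/-- item stmt-CriticalPhenomena-11236 · crux · rank 2 · open · by planner
why it might fail: Conditional independence is not weakly closed: an O(δ) shell may carry ε-sector data that the σ-germ of the limit does not generate (global Markov fails for some Gibbs states, Israel1986); the kernel ⟨·⟩^{h(ξ)}_Λ needs mesh-uniform control in a rough random field h.
sources: Goldstein1980, Israel1986, AlbeverioHeghkrohnZegarlinski1989, McKean1963, Nelson1973Construction, Rozanov1982
[crux] (MI) of the card. For every renormalisation ρ > 0 on (0,1], Δ, correlation family S and
probability law μ on FieldConfig ℝ³ = 𝒮'(ℝ³): if S is a pointwise scaling limit of criticalCorr 3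
(locally uniformly on non-coincident configurations), normalised to 0 off NonCoincident, with
non-degenerate two-point function, translation invariant and scale covariant with dimension Δ, and μ
has all moments, exponential moments and moment densities S (HasMomentDensity μ S — by Gaussian
domination μ is then THE Ising limit law), then μ is germ-Markov in McKean's sense for every open
ball and every open half-space U: for Σ(A) := ⨆_{tsupport f ⊆ A} σ(ω ↦ ω f), every bounded F
measurable for the inner germ field ⋂_{ε>0} Σ(U_ε) satisfies E_μ[F | ⋂_ε Σ((Uᶜ)_ε) ∨ ⋂_ε Σ((∂U)_ε)]
= E_μ[F | ⋂_ε Σ((∂U)_ε)] μ-a.e. Intended proof: the n.n. plus state is globally Markov with kernel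
E[F(σ_Λ) | σ_{Λᶜ} = ξ] = ⟨F⟩^{h(ξ)}_{Λ,β_c}, h_y(ξ) = β_c Σ_{z∼y, z∉Λ} ξ_z, depending on ξ only
through the lattice germ of ∂Λ at every mesh; show these kernels converge compatibly along the field
scaling limit (uniform control of ⟨·⟩^{h}_{Λ} in the random boundary field h without linearisation:
GHS / random currents), then -/
@[route_item "route-CriticalPhenomena-MarkovRigidity", crux]
def MarkovInheritance : Prop :=
  ∀ (ρ : ℝ → ℝ) (Δ : ℝ) (S : Literature.Probability.LatticeModels.CorrFamily 3) (μ : MeasureTheory.Measure (Literature.MathematicalPhysics.QuantumLattice.FieldConfig (EuclideanSpace ℝ (Fin 3)))), (∀ δ ∈ Set.Ioc (0:ℝ) 1, 0 < ρ δ) → Literature.Probability.LatticeModels.HasPointwiseScalingLimit (Literature.Probability.LatticeModels.criticalCorr 3) ρ S → (∀ n z, z ∉ Literature.Probability.LatticeModels.NonCoincident 3 n → S n z = 0) → Literature.Probability.LatticeModels.IsNondegenerateTwoPoint S → Literature.Probability.LatticeModels.IsTranslationInvariant S → Literature.Probability.LatticeModels.IsScaleCovariant Δ S → MeasureTheory.IsProbabilityMeasure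 μ → Literature.MathematicalPhysics.QuantumLattice.HasAllMoments μ → (∀ f : SchwartzMap (EuclideanSpace ℝ (Fin 3)) ℝ, MeasureTheory.Integrable (fun ω : Literature.MathematicalPhysics.QuantumLattice.FieldConfig (EuclideanSpace ℝ (Fin 3)) => Real.exp (ω f)) μ) → (∀ (n : ℕ) (f : Fin n → SchwartzMap (EuclideanSpace ℝ (Fin 3)) ℝ), Literature.MathematicalPhysics.QuantumLattice.moment μ n f = ∫ x : Fin n → EuclideanSpace ℝ (Fin 3), S n x * ∏ i, f i (x i)) → ∀ (sig : Set (EuclideanSpace ℝ (Fin 3)) → MeasurableSpace (Literature.MathematicalPhysics.QuantumLattice.FieldConfig (EuclideanSpace ℝ (Fin 3)))), (sig = fun A => ⨆ (f : SchwartzMap (EuclideanSpace ℝ (Fin 3)) ℝ) (_ : tsupport ⇑f ⊆ A), MeasurableSpace.comap (fun ω : Literature.MathematicalPhysics.QuantumLattice.FieldConfig (EuclideanSpace ℝ (Fin 3)) => ω f) (borel ℝ)) → ∀ (U : Set (EuclideanSpace ℝ (Fin 3))), ((∃ (c : EuclideanSpace ℝ (Fin 3)) (r : ℝ), U = Metric.ball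 c r) ∨ (∃ (v : EuclideanSpace ℝ (Fin 3)) (a : ℝ), v ≠ 0 ∧ U = {x | a < inner ℝ x v})) → ∀ (F : Literature.MathematicalPhysics.QuantumLattice.FieldConfig (EuclideanSpace ℝ (Fin 3)) → ℝ), @Measurable _ _ (⨅ (ε : ℝ) (_ : 0 < ε), sig (Metric.thickening ε U)) _ F → (∃ C : ℝ, ∀ ω, |F ω| ≤ C) → MeasureTheory.condExp ((⨅ (ε : ℝ) (_ : 0 < ε), sig (Metric.thickening ε Uᶜ)) ⊔ ⨅ (ε : ℝ) (_ : 0 < ε), sig (Metric.thickening ε (frontier U))) μ F =ᵐ[μ] MeasureTheory.condExp (⨅ (ε : ℝ) (_ : 0 < ε), sig (Metric.thickening ε (frontier U))) μ F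

-- earlier NelsonPolyakovRigidity (stmt-CriticalPhenomena-6227, replaced 2026-08-15T16:54:15Z -> stmt-CriticalPhenomena-11243): retired by None — ∀ (μ : MeasureTheory.Measure (Literature.MathematicalPhysics.QuantumLattice.FieldConfig (EuclideanSpace ℝ (Fin 3)))) (Δ : ℝ) (S : Literature.Probability.LatticeModels.CorrFamily 3), MeasureTheory.IsProbabilityMeasure μ → Literature.MathematicalPhysics.Quant
/-- item stmt-CriticalPhenomena-11243 · crux · rank 3 · open · by planner
why it might fail: It is Polyakov's conjecture in Nelson's axioms: a non-Gaussian scalar germ-Markov RP scale-covariant field with a dimension-2 virial current may exist in d=3 (none known; non-unitary holographic SFTs: Nakayama2017; Ising Δ_V>5 only numerically); Gaussian case needs Kotani (1.3)–(1.4).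
sources: Polyakov1970, Nakayama2015, Nakayama2017, DelamotteTissierWschebor2016, MenesesEtAl2019, ElshowkNakayamaRychkov2011
[crux] (NPR) of the card, single real scalar field (load-bearing: for multiplets it is false —
linear elasticity, RivaCardy2005 / ElshowkNakayamaRychkov2011; a single elastic component u₁ is NOT
germ-Markov since 1/σ₁₁ = μ‖k‖⁴/((1−γ)k₁²+k₂²+k₃²) is not entire), lattice-free. For every
probability law μ on 𝒮'(ℝ³), Δ and S: if μ has all moments and exponential moments, is translation
invariant, scale covariant with dimension Δ (law level: ω ↦ ω∘(f ↦ s^{Δ−3}f(·/s)) preserves μ),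
invariant under the time reflection θ: x₀ ↦ −x₀, OS3 reflection positive w.r.t. θ, OS4
time-clustering (S{f + T_t g} → S{f}S{g}; excludes the germ-Markov non-clustering MIXTURES
½(GFF_{Q₁} + GFF_{Q₂}), a counterexample to the unclustered statement), germ-Markov for all open
balls and open half-spaces exactly as in MarkovInheritance, 1/2 ≤ Δ ≤ 1, and its moment densities S
(HasMomentDensity μ S) are normalised to 0 off NonCoincident, continuous on NonCoincident and have
S₂ > 0 there — then there is a continuous linear automorphism A of ℝ³ such that (n, x) ↦ S n (A ∘ x)
is Möbius covariant with weight Δ (Euclidean invariant, scale covariant, unit-inversion covariant).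
Gaussian case = Kotani1973 Thm 2 + Homogeneo -/
@[route_item "route-CriticalPhenomena-MarkovRigidity", crux]
def NelsonPolyakovRigidity : Prop :=
  ∀ (μ : MeasureTheory.Measure (Literature.MathematicalPhysics.QuantumLattice.FieldConfig (EuclideanSpace ℝ (Fin 3)))) (Δ : ℝ) (S : Literature.Probability.LatticeModels.CorrFamily 3), MeasureTheory.IsProbabilityMeasure μ → Literature.MathematicalPhysics.QuantumLattice.HasAllMoments μ → (∀ f : SchwartzMap (EuclideanSpace ℝ (Fin 3)) ℝ, MeasureTheory.Integrable (fun ω : Literature.MathematicalPhysics.QuantumLattice.FieldConfig (EuclideanSpace ℝ (Fin 3)) => Real.exp (ω f)) μ) → Literature.MathematicalPhysics.QuantumLattice.IsTranslationInvariantLaw μ → (∀ (s : ℝ) (hs : 0 < s), MeasureTheory.Measure.map (Literature.MathematicalPhysics.QuantumLattice.FieldConfig.act ((s ^ (Δ - 3 : ℝ)) • Literature.MathematicalPhysics.QuantumLattice.dilateTest s hs.ne')) μ = μ) → Literature.MathematicalPhysics.QuantumLattice.IsTimeReflectionInvariantLaw 3 μ → (∀ (n : ℕ) (c : Fin n → ℂ)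 (f : Fin n → SchwartzMap (EuclideanSpace ℝ (Fin 3)) ℝ), (∀ i, tsupport ⇑(f i) ⊆ {x : EuclideanSpace ℝ (Fin 3) | 0 < x 0}) → 0 ≤ (∑ i, ∑ j, (starRingEnd ℂ) (c i) * c j * Literature.MathematicalPhysics.QuantumLattice.genFunctional μ (f j - Literature.MathematicalPhysics.QuantumLattice.thetaTest 3 (f i))).re ∧ (∑ i, ∑ j, (starRingEnd ℂ) (c i) * c j * Literature.MathematicalPhysics.QuantumLattice.genFunctional μ (f j - Literature.MathematicalPhysics.QuantumLattice.thetaTest 3 (f i))).im = 0) → (∀ f g : SchwartzMap (EuclideanSpace ℝ (Fin 3)) ℝ, Filter.Tendsto (fun t : ℝ => Literature.MathematicalPhysics.QuantumLattice.genFunctional μ (f + Literature.MathematicalPhysics.QuantumLattice.timeShiftTest 3 t g)) Filter.atTop (nhds (Literature.MathematicalPhysics.QuantumLattice.genFunctional μ f * Literature.MathematicalPhysics.QuantumLattice.genFunctional μ g))) → (∀ (sig : Set (EuclideanSpace ℝ (Fin 3)) → MeasurableSpace (Literature.MathematicalPhysics.QuantumLattice.FieldConfig (EuclideanSpace ℝ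 (Fin 3)))), (sig = fun A => ⨆ (f : SchwartzMap (EuclideanSpace ℝ (Fin 3)) ℝ) (_ : tsupport ⇑f ⊆ A), MeasurableSpace.comap (fun ω : Literature.MathematicalPhysics.QuantumLattice.FieldConfig (EuclideanSpace ℝ (Fin 3)) => ω f) (borel ℝ)) → ∀ (U : Set (EuclideanSpace ℝ (Fin 3))), ((∃ (c : EuclideanSpace ℝ (Fin 3)) (r : ℝ), U = Metric.ball c r) ∨ (∃ (v : EuclideanSpace ℝ (Fin 3)) (a : ℝ), v ≠ 0 ∧ U = {x | a < inner ℝ x v})) → ∀ (F : Literature.MathematicalPhysics.QuantumLattice.FieldConfig (EuclideanSpace ℝ (Fin 3)) → ℝ), @Measurable _ _ (⨅ (ε : ℝ) (_ : 0 < ε), sig (Metric.thickening ε U)) _ F → (∃ C : ℝ, ∀ ω, |F ω| ≤ C) → MeasureTheory.condExp ((⨅ (ε : ℝ) (_ : 0 < ε), sig (Metric.thickening ε Uᶜ)) ⊔ ⨅ (ε : ℝ) (_ : 0 < ε), sig (Metric.thickening ε (frontier U))) μ F =ᵐ[μ] MeasureTheory.condExp (⨅ (ε : ℝ) (_ : 0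 < ε), sig (Metric.thickening ε (frontier U))) μ F) → 1 / 2 ≤ Δ → Δ ≤ 1 → (∀ (n : ℕ) (f : Fin n → SchwartzMap (EuclideanSpace ℝ (Fin 3)) ℝ), Literature.MathematicalPhysics.QuantumLattice.moment μ n f = ∫ x : Fin n → EuclideanSpace ℝ (Fin 3), S n x * ∏ i, f i (x i)) → (∀ n z, z ∉ Literature.Probability.LatticeModels.NonCoincident 3 n → S n z = 0) → (∀ n, ContinuousOn (S n) (Literature.Probability.LatticeModels.NonCoincident 3 n)) → Literature.Probability.LatticeModels.IsNondegenerateTwoPoint S → ∃ A : EuclideanSpace ℝ (Fin 3) ≃L[ℝ] EuclideanSpace ℝ (Fin 3), Literature.Probability.LatticeModels.IsMoebiusCovariant Δ (fun n x => S n (fun i => A (x i)))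

/-- item stmt-CriticalPhenomena-1981 · crux · rank 4 · SPLIT (gen 3) into TwoPointDoubling, ClusterSetTotallyDisconnected + glue Summit.CriticalPhenomena.Ising3DConformalLimit.Cruxes.ExistsScaleCovariantLimit.PositivityBegetsConformalityMaps.crux_of_doubling_of_totallyDisconnected · direct attempts still welcome (low priority) · by planner
why it might fail: Full δ→0⁺ convergence with ONE continuous Δ is open on ℤ³: the two-point bounds give only subsequential limits, and RP/GKS two-point axiomatics admit log-periodic (discretely scale-covariant) profiles.
sources: DuminilCopinICM2022, DuminilcopinPanis2025, AizenmanDuminilCopinAnnals2021, Literature.Probability.LatticeModels.scalingDimension_mem_Icc_holds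
earlier split gen 1: TwoPointDoubling, ClusterSetTotallyDisconnected — retired -
earlier split gen 2: TwoPointDoubling, ClusterSetTotallyDisconnected — retired -
[crux r4, (C), existence WITHOUT rotations] There are ρ > 0 on (0,1], Δ > 0 and S with
HasPointwiseScalingLimit (criticalCorr 3) ρ S, S = 0 off NonCoincident, IsNondegenerateTwoPoint S,
IsTranslationInvariant S, IsScaleCovariant Δ S. Strictly weaker than CritIsing3DEuclideanLimit (item
0638: rotations included) — on this route isotropy is OUTPUT. Inputs in tree:
criticalTwoPoint_bounds_holds (c|x|⁻² ≤ G ≤ C|x|⁻¹ ⇒ subsequential limits, Δ ∈ [1/2,1]); missing: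
uniqueness/full-filter convergence and continuous scale covariance (DuminilCopinICM2022 §8.4 p.29:
'widely open'). -/
@[route_item "route-CriticalPhenomena-MarkovRigidity", crux]
def ExistsScaleCovariantLimit : Prop :=
  ∃ (ρ : ℝ → ℝ) (Δ : ℝ) (S : Literature.Probability.LatticeModels.CorrFamily 3), (∀ δ ∈ Set.Ioc (0:ℝ) 1, 0 < ρ δ) ∧ 0 < Δ ∧ Literature.Probability.LatticeModels.HasPointwiseScalingLimit (Literature.Probability.LatticeModels.criticalCorr 3) ρ S ∧ (∀ n z, z ∉ Literature.Probability.LatticeModels.NonCoincident 3 n → S n z = 0) ∧ Literature.Probability.LatticeModels.IsNondegenerateTwoPoint S ∧ Literature.Probability.LatticeModels.IsTranslationInvariant S ∧ Literature.Probability.LatticeModels.IsScaleCovariant Δ S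

-- parent: ExistsScaleCovariantLimit · child (gen 3)
/--     item stmt-CriticalPhenomena-6150 · crux · rank 401 · open
    parent: ExistsScaleCovariantLimit · by planner
    why it might fail: Open in print (ADC21 Rem 5.10): every two-point axiomatic in tree (all-mirror RP, MMS, IR/SSIR, DCP24 1.2/1.3, log-gradient) is passed by completely monotone episodic profiles losing doubling by unbounded factors (barrier p149925; Disproof §E W_ε): needs an Ising-specific 2-scale bound.
    sources: AizenmanDuminilCopinAnnals2021, arXiv:1912.07973, DuminilcopinPanis2025, arXiv:2404.05700, DuminilCopinICM2022, arXiv:2509.02850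
[crux] (D) ALL-SCALE DOUBLING of the axial critical two-point function on ℤ³: there is κ > 0 with
g(2n) ≥ κ·g(n) for all n ≥ 1, g(n) := ⟨σ₀σ_{n e₁}⟩⁺_{β_c(3)} (card item M3; = D1 of card
every-scale-regular-multiplicative-fekete). With MMS it gives G(z′) ≍ G(z) for ‖z′‖ ≍ ‖z‖ in all
directions; it is the one open LATTICE input of the compactness half and is filed first (the import
cone of everything below is otherwise proved: criticalTwoPoint_bounds_holds,
messager_miracleSole_holds, RP lemmas). [difficulty: open-problem] -/
@[route_item "route-CriticalPhenomena-MarkovRigidity", crux]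
def TwoPointDoubling : Prop :=
  ∃ κ : ℝ, 0 < κ ∧ ∀ n : ℕ, 1 ≤ n → κ * Literature.Probability.LatticeModels.criticalTwoPoint 3 (Pi.single 0 (n : ℤ)) ≤ Literature.Probability.LatticeModels.criticalTwoPoint 3 (Pi.single 0 (2 * (n : ℤ)))

-- parent: ExistsScaleCovariantLimit · child (gen 3)
/--     item stmt-CriticalPhenomena-4659 · crux · rank 402 · open
    parent: ExistsScaleCovariantLimit · by planner
    why it might fail: = uniqueness of the cluster point given compactness: fails if Δ drifts along scales (arc of pure-power cluster points), if the zoom has a limit cycle (DSI witnesses pass all two-point axiomatics, Disproof §E), or if cluster points evade locality; isolation of local 3D CFTs is expected, not proved.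
    sources: Rychkov2020, arXiv:2007.14315, PolandRychkovVichi2019, arXiv:1805.04405, DuminilCopinICM2022, Literature.Probability.LatticeModels.PointwiseScalingLimitDiscreteScaleInvariance
[crux] the cluster set 𝒞 of the self-normalised family is totally disconnected in the pointwise
(product) topology of CorrFamily 3 (on 𝒞, compact under Reg, this coincides with the locally uniform
topology; pointwise is the stronger ask otherwise). INTENDED ENGINE (card items (2)–(4), the route's
point, layer 2): 𝒞 ⊆ 𝓘 := σ-correlator families of LOCAL unitary ℤ₂-symmetric 3D CFTs with exactly
one relevant odd and exactly one relevant non-identity even scalar and Δ_σ ≤ 1 (lattice side: OS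
positivity, clustering, covariance and spectrum of cluster points), and 𝓘 is totally disconnected
(CFT side, lattice-blind: 'It is expected that most local CFTs are isolated. One exception are CFTs
with exactly marginal fields of dimension Δ = d … A folk conjecture says that exactly marginal
fields in d ≥ 3 require supersymmetry' — Rychkov2020, arXiv:2007.14315 p.8, read this session; LOCAL
= 'critical points of lattice models with finite-range interactions', ibid., which is what excludes
the non-local long-range arc; an ANALYTIC isolation theorem for exact solutions of crossing — NOT a
finite-Λ positivity certificate, which only gives diam ≤ ε(Λ): refuter flag on the card, accepted).
Both halves -/
@[route_item "route-CriticalPhenomena-MarkovRigidity", crux]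
def ClusterSetTotallyDisconnected : Prop :=
  IsTotallyDisconnected {S : Literature.Probability.LatticeModels.CorrFamily 3 | (∀ n x, x ∉ Literature.Probability.LatticeModels.NonCoincident 3 n → S n x = 0) ∧ ∃ u : ℕ → ℝ, (∀ k, u k ∈ Set.Ioc (0:ℝ) 1) ∧ Filter.Tendsto u Filter.atTop (nhds 0) ∧ ∀ n, TendstoLocallyUniformlyOn (fun k => Literature.Probability.LatticeModels.rescaledCorrelator (Literature.Probability.LatticeModels.criticalCorr 3) (fun δ : ℝ => (Literature.Probability.LatticeModels.criticalTwoPoint 3 (Pi.single 0 ⌊δ⁻¹⌋)) ^ (-(1/2:ℝ))) n (u k)) (S n) Filter.atTop (Literature.Probability.LatticeModels.NonCoincident 3 n)}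

/-- glue for the split of `ExistsScaleCovariantLimit`: landed theorem `Summit.CriticalPhenomena.Ising3DConformalLimit.Cruxes.ExistsScaleCovariantLimit.PositivityBegetsConformalityMaps.crux_of_doubling_of_totallyDisconnected`. -/
theorem ExistsScaleCovariantLimitGlueBy_holds : TwoPointDoubling → ClusterSetTotallyDisconnected → ExistsScaleCovariantLimit := _root_.Summit.CriticalPhenomena.Ising3DConformalLimit.Cruxes.ExistsScaleCovariantLimit.PositivityBegetsConformalityMaps.crux_of_doubling_of_totallyDisconnected

/-- item stmt-CriticalPhenomena-0636 · crux · rank 5 · open · by planner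
why it might fail: No proof that U₄ ≢ 0 in d = 3: the double-current intersection probability at macroscopic separation must stay positive as δ → 0; RP long-range models on ℤ³ with α < 3/2 are Gaussian (LongRangeTrivialityOnZ3).
sources: AizenmanDuminilCopinAnnals2021, DuminilCopinICM2022, Panis2023Triviality
Crux r4 (non-triviality in d=3): every non-degenerate pointwise scaling limit S of the renormalised
critical Ising correlators on Z^3 has connected four-point function U4 ≢ 0 on non-coincident
configurations. Intended tool: the random-current identity U4(x,y,z,t) =
−2⟨σxσy⟩⟨σzσt⟩·P^{xy,zt}[C_{n1+n2}(x) ∩ C_{n1+n2}(z) ≠ ∅] (Aizenman 1982; ADC2021 arXiv:1912.07973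
eq. (3.11)): non-Gaussianity ⇔ the intersection probability of the two double-current clusters at
macroscopic separation does not vanish as δ → 0. Contrast: for d ≥ 4 every such limit IS Gaussian
(Literature.Probability.LatticeModels.highDim_triviality). Its negation refutes the conjunct
Ising3DConformalLimit itself. -/
@[route_item "route-CriticalPhenomena-MarkovRigidity", crux]
def IsingEuclidUpgradeR4NonGaussian : Prop :=
  ∀ (ρ : ℝ → ℝ) (S : Literature.Probability.LatticeModels.CorrFamily 3), (∀ δ ∈ Set.Ioc (0:ℝ) 1, 0 < ρ δ) → Literature.Probability.LatticeModels.HasPointwiseScalingLimit (Literature.Probability.LatticeModels.criticalCorr 3) ρ S → Literature.Probability.LatticeModels.IsNondegenerateTwoPoint S → Literature.Probability.LatticeModels.HasNontrivialU4 S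

-- earlier FieldRealisation (stmt-CriticalPhenomena-6228, replaced 2026-08-15T16:54:15Z -> stmt-CriticalPhenomena-11245): retired by None — ∀ (ρ : ℝ → ℝ) (Δ : ℝ) (S : Literature.Probability.LatticeModels.CorrFamily 3), (∀ δ ∈ Set.Ioc (0:ℝ) 1, 0 < ρ δ) → Literature.Probability.LatticeModels.HasPointwiseScalingLimit (Literature.Probability.LatticeModels.criticalCorr 3) ρ S → (∀ n z, z ∉ Literature.Prob
/-- item stmt-CriticalPhenomena-11245 · support · rank 9 · closed · proved by Summit.CriticalPhenomena.Ising3DConformalLimit.MarkovRigidityFieldRealisation.fieldRealisation_proof @ 1e832bd05bf2 (prover) · by planner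
sources: Newman1975Gaussian, GlimmJaffe1987, FrohlichIsraelLiebSimon1978, OsterwalderSchrader1973, AizenmanDuminilCopinSidoravicius2015
[support] Glue from the pointwise limit to the field: for every ρ > 0 on (0,1], Δ, S with the
hypotheses of ExistsScaleCovariantLimit, (a) each S n is continuous on NonCoincident 3 n
(translation invariance + locally uniform convergence of cell-wise constant functions), and (b)
there is a probability law μ on 𝒮'(ℝ³) with all moments, exponential moments (Newman's Gaussian-type
inequalities for the Lee–Yang class pass to the limit), moment densities S (smeared moments: Potter
bounds for the regularly varying ρ + Gaussian domination |S_{2n}| ≤ Σ_pairings ΠS₂ give uniform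
integrability near diagonals, 2Δ ≤ 2 < 3), translation-invariant and scale-covariant law (moment
determinacy from exponential moments), invariant under θ: x₀ ↦ −x₀, OS3 reflection positive
(site-reflection positivity of the n.n. model through the plane x₀ = 0, FrohlichIsraelLiebSimon1978,
passes to limits of generating functionals) and OS4 time-clustering (truncated correlations decay
like t^{-2Δ} by Lebowitz-type domination). μ is the limit in law of the rescaled spin fields (cf.
the field statement crit-ising.S02 in Literature/Probability/LatticeModels/FieldScalingLimit.lean,
deliberately NOT imported), but only it -/
@[route_item "route-CriticalPhenomena-MarkovRigidity", crux]
def FieldRealisation : Prop :=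
  ∀ (ρ : ℝ → ℝ) (Δ : ℝ) (S : Literature.Probability.LatticeModels.CorrFamily 3), (∀ δ ∈ Set.Ioc (0:ℝ) 1, 0 < ρ δ) → Literature.Probability.LatticeModels.HasPointwiseScalingLimit (Literature.Probability.LatticeModels.criticalCorr 3) ρ S → (∀ n z, z ∉ Literature.Probability.LatticeModels.NonCoincident 3 n → S n z = 0) → Literature.Probability.LatticeModels.IsNondegenerateTwoPoint S → Literature.Probability.LatticeModels.IsTranslationInvariant S → Literature.Probability.LatticeModels.IsScaleCovariant Δ S → (∀ n, ContinuousOn (S n) (Literature.Probability.LatticeModels.NonCoincident 3 n)) ∧ ∃ μ : MeasureTheory.Measure (Literature.MathematicalPhysics.QuantumLattice.FieldConfig (EuclideanSpace ℝ (Fin 3))), MeasureTheory.IsProbabilityMeasure μ ∧ Literature.MathematicalPhysics.QuantumLattice.HasAllMoments μ ∧ (∀ f : SchwartzMap (EuclideanSpace ℝ (Fin 3)) ℝ, MeasureTheory.Integrable (fun ω : Literature.MathematicalPhysics.QuantumLattice.FieldConfig (EuclideanSpace ℝ (Fin 3)) => Real.exp (ω f)) μ) ∧ (∀ (n : ℕ)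 (f : Fin n → SchwartzMap (EuclideanSpace ℝ (Fin 3)) ℝ), Literature.MathematicalPhysics.QuantumLattice.moment μ n f = ∫ x : Fin n → EuclideanSpace ℝ (Fin 3), S n x * ∏ i, f i (x i)) ∧ Literature.MathematicalPhysics.QuantumLattice.IsTranslationInvariantLaw μ ∧ (∀ (s : ℝ) (hs : 0 < s), MeasureTheory.Measure.map (Literature.MathematicalPhysics.QuantumLattice.FieldConfig.act ((s ^ (Δ - 3 : ℝ)) • Literature.MathematicalPhysics.QuantumLattice.dilateTest s hs.ne')) μ = μ) ∧ Literature.MathematicalPhysics.QuantumLattice.IsTimeReflectionInvariantLaw 3 μ ∧ (∀ (n : ℕ) (c : Fin n → ℂ) (f : Fin n → SchwartzMap (EuclideanSpace ℝ (Fin 3)) ℝ), (∀ i, tsupport ⇑(f i) ⊆ {x : EuclideanSpace ℝ (Fin 3) | 0 < x 0}) → 0 ≤ (∑ i, ∑ j, (starRingEnd ℂ) (c i) * c j * Literature.MathematicalPhysics.QuantumLattice.genFunctional μ (f j - Literature.MathematicalPhysics.QuantumLattice.thetaTest 3 (f i))).re ∧ (∑ i, ∑ j, (starRingEnd ℂ)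 (c i) * c j * Literature.MathematicalPhysics.QuantumLattice.genFunctional μ (f j - Literature.MathematicalPhysics.QuantumLattice.thetaTest 3 (f i))).im = 0) ∧ (∀ f g : SchwartzMap (EuclideanSpace ℝ (Fin 3)) ℝ, Filter.Tendsto (fun t : ℝ => Literature.MathematicalPhysics.QuantumLattice.genFunctional μ (f + Literature.MathematicalPhysics.QuantumLattice.timeShiftTest 3 t g)) Filter.atTop (nhds (Literature.MathematicalPhysics.QuantumLattice.genFunctional μ f * Literature.MathematicalPhysics.QuantumLattice.genFunctional μ g)))

-- `FieldRealisation` holds: proved by `Summit.CriticalPhenomena.Ising3DConformalLimit.MarkovRigidityFieldRealisation.fieldRealisation_proof` @ 1e832bd05bf2 (its module imports this route file, so no `_holds` link can be stated here).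

/-- item stmt-CriticalPhenomena-6229 · support · rank 9 · closed · proved by Summit.CriticalPhenomena.Ising3DConformalLimit.MarkovRigidityCubicSymmetry.cubicSymmetryOfLimit_proof @ f42349d5b6d8 (prover) · by planner
sources: FriedliVelenik2017, DuminilCopinICM2022
[support] Hyperoctahedral (B₃ = signed permutation) invariance of the limit: for every ρ > 0 on
(0,1], Δ, S with the hypotheses of ExistsScaleCovariantLimit and every linear isometry L of ℝ³
permuting the set {±e_i}, S n (L∘x) = S n x for all n and all configurations x. From invariance of
the critical plus state under lattice automorphisms of ℤ³ fixing 0 (coordinate permutations commute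
with the floor map latticeApprox; sign changes are off by one lattice unit, absorbed by translation
invariance and the continuity of S on NonCoincident; off NonCoincident both sides vanish by
normalisation, L being injective). [difficulty: M] -/
@[route_item "route-CriticalPhenomena-MarkovRigidity", crux]
def CubicSymmetryOfLimit : Prop :=
  ∀ (ρ : ℝ → ℝ) (Δ : ℝ) (S : Literature.Probability.LatticeModels.CorrFamily 3), (∀ δ ∈ Set.Ioc (0:ℝ) 1, 0 < ρ δ) → Literature.Probability.LatticeModels.HasPointwiseScalingLimit (Literature.Probability.LatticeModels.criticalCorr 3) ρ S → (∀ n z, z ∉ Literature.Probability.LatticeModels.NonCoincident 3 n → S n z = 0) → Literature.Probability.LatticeModels.IsNondegenerateTwoPoint S → Literature.Probability.LatticeModels.IsTranslationInvariant S → Literature.Probability.LatticeModels.IsScaleCovariant Δ S → ∀ (L : EuclideanSpace ℝ (Fin 3) ≃ₗᵢ[ℝ] EuclideanSpace ℝ (Fin 3)), (∀ i : Fin 3, ∃ j : Fin 3, L (EuclideanSpace.single i 1) = EuclideanSpace.single j 1 ∨ L (EuclideanSpace.single i 1) = -EuclideanSpace.single j 1) → ∀ (n : ℕ) (x : Fin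 n → EuclideanSpace ℝ (Fin 3)), S n (fun k => L (x k)) = S n x

-- `CubicSymmetryOfLimit` holds: proved by `Summit.CriticalPhenomena.Ising3DConformalLimit.MarkovRigidityCubicSymmetry.cubicSymmetryOfLimit_proof` @ f42349d5b6d8 (its module imports this route file, so no `_holds` link can be stated here).

/-- item stmt-CriticalPhenomena-6230 · support · rank 9 · closed · proved by Summit.CriticalPhenomena.Ising3DConformalLimit.Theorems.CubicClosure_proof @ 5a4875acc482 (prover) · by planner
sources: PolandRychkovVichi2019, FrancescoMathieuSenechal1997
[support] Elementary glue 'an O_h-invariant metric is round': for Δ > 0, a correlation family S on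
ℝ³ with S₂ > 0 on NonCoincident which is invariant under all signed permutation isometries, and a
continuous linear automorphism A with S∘A Möbius covariant of weight Δ, S itself is Möbius covariant
of weight Δ. Proof: rotation + scale invariance of S∘A give (S∘A)₂(0,u) = g₀‖u‖^{-2Δ}, g₀ > 0, so
S₂(0,w) = g₀‖A⁻¹w‖^{-2Δ}; B₃-invariance of S and Δ ≠ 0 make the quadratic form ‖A⁻¹w‖² B₃-invariant,
hence λ‖w‖² (sign flips kill off-diagonal entries, transpositions equalise the diagonal), so A⁻¹ =
√λ·R with R ∈ O(3) and S n = λ^{-nΔ/2}·(S∘A) n; all four covariance properties are stable under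
n-dependent positive constants. [difficulty: provable-now] -/
@[route_item "route-CriticalPhenomena-MarkovRigidity", crux]
def CubicClosure : Prop :=
  ∀ (Δ : ℝ) (S : Literature.Probability.LatticeModels.CorrFamily 3) (A : EuclideanSpace ℝ (Fin 3) ≃L[ℝ] EuclideanSpace ℝ (Fin 3)), 0 < Δ → Literature.Probability.LatticeModels.IsNondegenerateTwoPoint S → (∀ (L : EuclideanSpace ℝ (Fin 3) ≃ₗᵢ[ℝ] EuclideanSpace ℝ (Fin 3)), (∀ i : Fin 3, ∃ j : Fin 3, L (EuclideanSpace.single i 1) = EuclideanSpace.single j 1 ∨ L (EuclideanSpace.single i 1) = -EuclideanSpace.single j 1) → ∀ (n : ℕ) (x : Fin n → EuclideanSpace ℝ (Fin 3)), S n (fun k => L (x k)) = S n x) → Literature.Probability.LatticeModels.IsMoebiusCovariant Δ (fun n x => S n (fun i => A (x i))) → Literature.Probability.LatticeModels.IsMoebiusCovariant Δ S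

-- `CubicClosure` holds: proved by `Summit.CriticalPhenomena.Ising3DConformalLimit.Theorems.CubicClosure_proof` @ 5a4875acc482 (its module imports this route file, so no `_holds` link can be stated here).

/-- item stmt-CriticalPhenomena-6231 · support · rank 9 · closed · proved by Summit.CriticalPhenomena.Ising3DConformalLimit.Theorems.homogeneousEntireRigidity_proof @ fe3497deb60e (prover) · by planner
sources: Kotani1973, Pitt1971, Dobrushin1979, Rozanov1982
[support] The Gaussian shadow of NPR after Kotani's criterion, pure complex analysis (provable now):
if P : ℂ³ → ℂ is entire (analytic at every point), real and ≥ 0 on ℝ³, not identically 0 on ℝ³,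
positively homogeneous of degree m ∈ (0,3) on ℝ³ (P(ck) = c^m P(k), c > 0) and 1/P is locally
integrable on ℝ³, then m = 2 and P|ℝ³ is a positive-definite quadratic form k ↦ Σ Q_ij k_i k_j.
Proof: for real k, t ↦ P(tk) is entire in t ∈ ℂ and equals t^m P(k) for t > 0, so single-valuedness
forces m ∈ ℕ or P(k) = 0; hence m ∈ {1,2} and P|ℝ³ is a homogeneous polynomial of degree m; m = 1
contradicts P ≥ 0, P ≢ 0; m = 2 gives a PSD form whose reciprocal is locally integrable in ℝ³ only
at full rank. With Kotani1973 Thm 2 (σ⁻¹ = P entire of minimal exponential type for a germ-Markov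
stationary Gaussian field) and σ⁻¹ homogeneous of degree 3 − 2Δ this is 'Markov + scale ⇒ massless
free field of the metric Q, Δ = 1/2'. [difficulty: provable-now] -/
@[route_item "route-CriticalPhenomena-MarkovRigidity", crux]
def HomogeneousEntireRigidity : Prop :=
  ∀ (m : ℝ) (P : (Fin 3 → ℂ) → ℂ), 0 < m → m < 3 → (∀ z, AnalyticAt ℂ P z) → (∃ k : Fin 3 → ℝ, P (fun i => (k i : ℂ)) ≠ 0) → (∀ k : Fin 3 → ℝ, 0 ≤ (P (fun i => (k i : ℂ))).re ∧ (P (fun i => (k i : ℂ))).im = 0) → (∀ (c : ℝ) (k : Fin 3 → ℝ), 0 < c → P (fun i => ((c * k i : ℝ) : ℂ)) = ((c ^ m : ℝ) : ℂ) * P (fun i => (k i : ℂ))) → MeasureTheory.LocallyIntegrable (fun k : Fin 3 → ℝ => 1 / (P (fun i => (k i : ℂ))).re) → m = 2 ∧ ∃ Q : Matrix (Fin 3) (Fin 3) ℝ, Q.PosDef ∧ ∀ k : Fin 3 → ℝ, ((P (fun i => (k i : ℂ))).re = ∑ i, ∑ j, Q i j * k i * k j)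

-- `HomogeneousEntireRigidity` holds: proved by `Summit.CriticalPhenomena.Ising3DConformalLimit.Theorems.homogeneousEntireRigidity_proof` @ fe3497deb60e (its module imports this route file, so no `_holds` link can be stated here).

-- earlier Assembly (stmt-CriticalPhenomena-6232, replaced 2026-08-15T12:11:53Z -> stmt-CriticalPhenomena-7564): retired by None — MarkovInheritance → NelsonPolyakovRigidity → ExistsScaleCovariantLimit → FieldRealisation → CubicSymmetryOfLimit → CubicClosure → NonGaussianity → Summit.CriticalPhenomena.Ising3DConformalLimit
/-- item stmt-CriticalPhenomena-7564 · assembly · rank 1 · closed · proved by Summit.CriticalPhenomena.Ising3DConformalLimit.Theorems.markovRigidity_assembly_proof @ 53dd680968fd (prover) · by planner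
sources: DuminilCopinICM2022, Nelson1973Construction, Kotani1973
[assembly] MarkovInheritance → NelsonPolyakovRigidity → ExistsScaleCovariantLimit → FieldRealisation
→ CubicSymmetryOfLimit → CubicClosure → IsingEuclidUpgradeR4NonGaussian (= NonGaussianity, item
0636) → Ising3DConformalLimit. Proof (checked rc 0, standard axioms, planner folder
RouteFileCheck.lean against the materialised rev-1 file): take (ρ, Δ, S) from
ExistsScaleCovariantLimit; FieldRealisation gives continuity of S on NonCoincident and a law μ;
MarkovInheritance makes μ germ-Markov; scalingDimension_mem_Icc_holds gives 1/2 ≤ Δ ≤ 1;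
NelsonPolyakovRigidity gives A with S∘A Möbius; CubicSymmetryOfLimit + CubicClosure give
IsMoebiusCovariant Δ S; IsingEuclidUpgradeR4NonGaussian gives HasNontrivialU4 S. -/
@[route_item "route-CriticalPhenomena-MarkovRigidity", crux]
def Assembly : Prop :=
  MarkovInheritance → NelsonPolyakovRigidity → ExistsScaleCovariantLimit → FieldRealisation → CubicSymmetryOfLimit → CubicClosure → IsingEuclidUpgradeR4NonGaussian → Ising3DConformalLimit

-- `Assembly` holds: proved by `Summit.CriticalPhenomena.Ising3DConformalLimit.Theorems.markovRigidity_assembly_proof` @ 53dd680968fd (its module imports this route file, so no `_holds` link can be stated here).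

/-! D-0027 §2.1 — DECIDING THEOREM (planner-authored via `route open/edit --closes-file`; by operator:999:875655 2026-08-15T14:44:33Z):
its hypotheses are this route's items and its conclusion the sub-problem Statement (glue_lint), and it elaborates with this file. -/

@[closes "route-CriticalPhenomena-MarkovRigidity"] theorem closes : MarkovInheritance → NelsonPolyakovRigidity → ExistsScaleCovariantLimit → IsingEuclidUpgradeR4NonGaussian → FieldRealisation → CubicSymmetryOfLimit → CubicClosure → HomogeneousEntireRigidity → Assembly → _root_.Ising3DConformalLimit := fun h_MarkovInheritance h_NelsonPolyakovRigidity h_ExistsScaleCovariantLimit h_IsingEuclidUpgradeR4NonGaussian h_FieldRealisation h_CubicSymmetryOfLimit h_CubicClosure h_HomogeneousEntireRigidity h_Assembly => h_Assembly h_MarkovInheritance h_NelsonPolyakovRigidity h_ExistsScaleCovariantLimit h_FieldRealisation h_CubicSymmetryOfLimit h_CubicClosure h_IsingEuclidUpgradeR4NonGaussian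

end Summit.CriticalPhenomena.Ising3DConformalLimit.Theses.MarkovRigidity
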